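import Summits.QuantumFields.YangMills.Theorems.ParabolicTrajectoryContinuumLimitOnTrajectoryStubTranslB

/-!
# Crux `ContinuumLimitOnTrajectory` (stmt-QuantumFields-10522), line `two-orbit-synchronisation` (seat c2):
# glue `UUVB → UVB`

Helper (`--supports stmt-QuantumFields-10522`): the uniform-threshold plaquette-string bounds `UUVB r sch` (…DefsC) imply the
per-test-function curvature bounds `UVB r sch` (…Defs), so the input stub `stub_uvInputs : UVInputs` carries `UVB` redundantly.
Via worker B's expansion bound `Transl.norm_curvDistribution_le_of_uuvb` (`‖cD_k F‖ ≤ 6^p · α (p!)^β |F|_{ps}`) and `6^p ≤ 65·p!`.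
-/

set_option autoImplicit false

open scoped SchwartzMap
open MeasureTheory Filter Topology Set
open Literature.MathematicalPhysics.QuantumFieldTheory Literature.MathematicalPhysics.QuantumLattice
open Literature.MathematicalPhysics.AQFT Literature.Probability.LatticeModels

noncomputable section

namespace Summit.QuantumFields.YangMills.Cruxes.ContinuumLimitOnTrajectory.TwoOrbitSynchronisation

/-- There are six plaquette orientations in four dimensions. -/
theorem card_plaqIdx : Fintype.card PlaqIdx = 6 := by
  unfold PlaqIdx; decide

/-- `6^p ≤ 65 · p!`. -/
theorem six_pow_le_factorial (p : ℕ) : (6 : ℝ) ^ p ≤ 65 * (p.factorial : ℝ) := by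
  suffices h : ∀ q : ℕ, (6 : ℝ) ^ (q + 6) ≤ 65 * ((q + 6).factorial : ℝ) by
    rcases Nat.lt_or_ge p 6 with hp | hp
    · interval_cases p <;> norm_num [Nat.factorial]
    · obtain ⟨q, rfl⟩ := Nat.exists_eq_add_of_le' hp
      exact h q
  intro q
  induction q with
  | zero => norm_num [Nat.factorial]
  | succ q ih =>
    rw [show q + 1 + 6 = (q + 6) + 1 from by ring, pow_succ, Nat.factorial_succ, Nat.cast_mul]
    have h6 : (6 : ℝ) ≤ ((q + 6 + 1 : ℕ) : ℝ) := by exact_mod_cast (by omega : 6 ≤ q + 6 + 1)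
    have hf : (0 : ℝ) ≤ ((q + 6).factorial : ℝ) := Nat.cast_nonneg _
    calc (6 : ℝ) ^ (q + 6) * 6 ≤ 65 * ((q + 6).factorial : ℝ) * 6 := by gcongr
      _ ≤ 65 * (((q + 6 + 1 : ℕ) : ℝ) * ((q + 6).factorial : ℝ)) := by nlinarith

/-- **`UUVB → UVB`** (registered glue): uniform-threshold plaquette-string bounds give the per-test-function curvature bounds, with
constants `(65 · max α 0, β + 1)`. -/
theorem uvb_of_uuvb :
    ∀ {G : Type} [Group G] [TopologicalSpace G] [IsTopologicalGroup G] [CompactSpace G] [MeasurableSpace G] [BorelSpace G]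
      (r : LatticeRep G) (sch : SpeciesScheme (YMSpecies G)), UUVB r sch → UVB r sch := by
  intro G _ _ _ _ _ _ r sch hU
  obtain ⟨s, α, β, h⟩ := Transl.norm_curvDistribution_le_of_uuvb r sch hU
  refine ⟨s, 65 * max α 0, β + 1, fun p F hF => h.mono fun k hk => ?_⟩
  have h1 := hk p F hF
  rw [card_plaqIdx] at h1
  push_cast at h1
  have hα : α ≤ max α 0 := le_max_left _ _
  have hsn : 0 ≤ schwartzNorm (p * s) F := schwartzNorm_nonneg _ _
  have hfb : 0 ≤ (p.factorial : ℝ) ^ β := Real.rpow_nonneg (Nat.cast_nonneg _) _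
  have hX : 0 ≤ max α 0 * (p.factorial : ℝ) ^ β * schwartzNorm (p * s) F :=
    mul_nonneg (mul_nonneg (le_max_right _ _) hfb) hsn
  calc ‖curvDistribution r sch k p F‖ ≤ (6 : ℝ) ^ p * (α * (p.factorial : ℝ) ^ β * schwartzNorm (p * s) F) := h1
    _ ≤ (6 : ℝ) ^ p * (max α 0 * (p.factorial : ℝ) ^ β * schwartzNorm (p * s) F) :=
        mul_le_mul_of_nonneg_left (mul_le_mul_of_nonneg_right (mul_le_mul_of_nonneg_right hα hfb) hsn) (by positivity)
    _ ≤ (65 * (p.factorial : ℝ)) * (max α 0 * (p.factorial : ℝ) ^ β * schwartzNorm (p * s) F) :=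
        mul_le_mul_of_nonneg_right (six_pow_le_factorial p) hX
    _ = 65 * max α 0 * (p.factorial : ℝ) ^ (β + 1) * schwartzNorm (p * s) F := by
        rw [Real.rpow_add_one (Nat.cast_ne_zero.2 (Nat.factorial_ne_zero p))]
        ring

end Summit.QuantumFields.YangMills.Cruxes.ContinuumLimitOnTrajectory.TwoOrbitSynchronisation

end
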